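import Mathlib
import HarnessLib
import Literature.NumberTheory.Automorphic.AutomorphicInductionCuspidal
import Literature.NumberTheory.Automorphic.GLnAdelicStructureProofs
import Summits.Langlands.Langlands.Theses.ExteriorSquareAscent

/-!
# Birth skeleton (BC3) for crux stmt-Langlands-18055
`Summit.Langlands.Langlands.Theses.ExteriorSquareAscent.SelfTwistedIrreducible` — line `birth`

Route `route-Langlands-ExteriorSquareAscent` (`closes : InducedSquareAscent → ReducibleInducesSquare →
SelfTwistedIrreducible → RestOfReciprocity → Langlands`). The crux (rank 4): for every number field `K`,
every cuspidal C-algebraic `π` on `GL₄(𝔸_K)` with a Hecke field which is SELF-TWISTED by the quadratic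
sign `ε_{L/K}` of some quadratic `L/K` at almost every place, every `ℓ, ι` and every SEMISIMPLE
`ρ : Γ_K → GL₄(ℚ̄_ℓ)` Satake–Frobenius compatible with `(π, ι)` a.e. (C-normalisation
`arithFrobPolyOfSatake ι q_v 4`) is irreducible — the induced case of Shavali2026 (arXiv:2603.19768)
Cor. 4.6 redone WITHOUT Galois representations over the quadratic field (`L` may be neither totally
real nor CM).

This file concludes the crux BY NAME from four named stubs, cut along the route's own two-layer plan
("SelfTwistedIrreducible ⇐ PotentiallyAbelianShapes → DoubledPairRigidity", route header § TWO-LAYER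
PLAN) with the two preparatory moves of the proof line made explicit (automorphic induction; the
Clifford dichotomy for an `ε`-self-twisted reducible `ρ`):

* `stub_automorphicInduction` (Arthur–Clozel 1989 Ch. 3 Thm 4.2 (b) + Thm 6.2 / Lemma 6.4, after
  Jacquet–Shalika SMO upgrades the Satake-level self-twist to `π ⊗ ε_{L/K} ≅ π`; size M, TRUE in
  substance): a cuspidal `π` on `GL₄(𝔸_K)` self-twisted by `ε_{L/K}` a.e. is automorphically induced
  (`IsAutomorphicInductionAlong f.1 π.1`, Def. 6.1 (6.1)–(6.2) at almost all places) from a cuspidal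
  `f` on `GL₂(𝔸_L)` that is NOT Galois-stable at Satake level (`¬ IsGaloisStableSatakeAE K f.1`, the
  shadow of `f ≇ f^γ`). Tree: fact `automorphicInduction_cyclic_cuspidal` (other direction of use),
  `ArthurClozel1989_inducedLift_of_twist_eq` (other carrier).
* `stub_cliffordDichotomy` (Chebotarev + Brauer–Nesbitt + Clifford theory for the index-2 subgroup
  `Γ_L`; size M, TRUE in substance): for such `π` and a semisimple compatible REDUCIBLE `ρ`,
  `tr ρ = 0` on `ε_{L/K} = -1` (Satake self-twist at inert places + density of Frobenii + continuity),
  so `ρ ≅ ρ ⊗ ε_{L/K}` (tree `FramedGaloisRep.nonempty_twist_equiv_of_trace_eq_zero`), whence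
  `ρ|_{Γ_L} ≅ V ⊕ V^γ` with `V` semisimple of dimension 2, and reducibility of `ρ` leaves exactly two
  shapes for `ρ|_{Γ_L}`: a sum of FOUR CHARACTERS (`V` reducible), or `W ⊕ W` with `W` IRREDUCIBLE
  2-dimensional (`ρ = σ ⊕ σ⊗ε`, `W = σ|_{Γ_L}`) — stated on characteristic polynomials
  (`IsSumOfFourCharacters`, `IsDoubledIrreducible`).
* `stub_noFourCharacters` (= PotentiallyAbelianShapes; Böckle–Hui local algebraicity — PROVED in tree,
  `exists_heckeCharacter_of_weaklyDivides_holds` — + exact GL(1) Euler products / Jacquet–Shalika; size L):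
  if `π = AI_{L/K}(f)` (C-algebraic, Hecke field) then no semisimple compatible `ρ` has `ρ|_{Γ_L}` a sum
  of four characters: the `ψ_i` would be algebraic Hecke characters of `L` with
  `{ψ_i(w)} = t_{f,w} ⊔ t_{f,w̄}` a.e., and `L^T(s, f × ψ₁⁻¹) L^T(s, f^γ × ψ₁⁻¹) = ζ_L^T(s) ∏_{i ≥ 2}
  L^T(s, ψ_i ψ₁⁻¹)` is entire on the left and has a pole at `s = 1` on the right.
* `stub_noDoubledShape` (= DoubledPairRigidity + the dihedral endgame; THE HARDEST STUB, size L): if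
  `π = AI_{L/K}(f)` with `f` not Galois-stable, no semisimple compatible `ρ` has `ρ|_{Γ_L}` of shape
  `W ⊕ W`, `W` irreducible: at a.e. split `v = w w̄` the Frobenius char-poly is a square, so
  `t_{f,w} ⊔ t_{f,w̄}` is a doubled pair, i.e. `t_{f,w} = t_{f,w̄}` off the set where `t_{f,w}` is
  scalar; for non-dihedral `f` that set has upper Dirichlet density `≤ 1/9 < 1/8` (simple pole of
  `L(s, Ad f × Ad f)`, prime powers by the `7/64` bound), so Ramakrishnan's refined SMO (tree fact
  `Ramakrishnan1994_refinedSMO_GL2`) gives `f ≅ f^γ`, contradicting `¬ IsGaloisStableSatakeAE`; for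
  dihedral `f = AI_{M/L}(λ)`, `π = AI_{M/K}(λ)` (induction in stages, tree
  `IsAutomorphicInductionAlong.trans`), `λ` is algebraic because `π` is C-algebraic, `ρ ≅ Ind_M^K λ_ℓ`
  (Weil avatar + Brauer–Nesbitt) is irreducible by Mackey (cuspidality of `π`), and an irreducible `ρ`
  never restricts to `W ⊕ W` on an index-2 subgroup.

`SelfTwistedIrreducible_of` is propositional glue: the quadratic field `L` of the crux hypothesis is
fed to `stub_automorphicInduction` (with the PROVED `isCompact_glFiniteIntegralLevel_holds 2 L`) and to
`stub_cliffordDichotomy`; the two shapes are killed by stubs 3 and 4. No stub alone gives the crux or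
the summit (BC3 probes `bc/probe_*.lean`: all eight FAIL); the interfaces are typed in existing
carriers only (`CuspidalAutomorphicRepData`, `HasSatakeParamAt`, `IsAutomorphicInductionAlong`,
`IsGaloisStableSatakeAE`, `FramedGaloisRep`, `restrictField`, `Matrix.charpoly`).

Disproof used: none exists for this crux (`ledger crux ls stmt-Langlands-18055`: no workfiles before
this one); the crux's only `why it might fail` (density notion / Ramanujan bound in the `1/9 < 1/8`
step; small-order dihedral `λ/λ^c`) is carried by `stub_noDoubledShape` and named in its docstring;
negatives index of the summit (K3KugaSatakeDescent) not touched.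
-/

noncomputable section

set_option linter.dupNamespace false

namespace Summit.Langlands.Langlands.Cruxes.SelfTwistedIrreducible.Birth

open scoped NumberField Polynomial Classical
open Filter Polynomial NumberField IsDedekindDomain Field
open Literature.NumberTheory.GaloisRepresentations Literature.NumberTheory.Automorphic
open Summit.Langlands.Langlands.Theses.ExteriorSquareAscent (SelfTwistedIrreducible)

/-! ## The interfaces (the crux's own clauses, verbatim, plus the two Galois shapes) -/

section Interfaces

variable {K : Type} [Field K] [NumberField K] {hcpt : isCompact_glFiniteIntegralLevel 4 K}

/-- The crux's HECKE-FIELD clause for `π` on `GL₄(𝔸_K)`, VERBATIM: a number field `E ⊂ ℂ` containing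
the C-normalised Hecke polynomial coefficients `q_v^{i(4-i)/2} e_i(t_{π,v})` at almost every `v`. -/
def HasHeckeField (π : CuspidalAutomorphicRepData 4 K hcpt) : Prop :=
  ∃ E : Subfield ℂ, FiniteDimensional ℚ E ∧ ∀ᶠ v in cofinite, ∀ α : Multiset ℂ, π.1.HasSatakeParamAt v α → ∀ i ≤ 4, ((((Real.sqrt (v.residueCard : ℝ)) : ℝ) : ℂ) ^ (i * (4 - i))) * α.esymm i ∈ E

/-- The crux's SELF-TWIST clause, VERBATIM, for a given `L/K`: `[L : K] = 2` and, at almost every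
finite place `v` of `K`, `ε_{L/K}(v) · t_{π,v} = t_{π,v}` as multisets, where `ε_{L/K}(v) = 1` if
some place of `L` over `v` has residue degree `1` and `-1` otherwise (the tree's `quadraticSign L v`). -/
def IsQuadSelfTwisted (π : CuspidalAutomorphicRepData 4 K hcpt) (L : Type) [Field L] [NumberField L]
    [Algebra K L] : Prop :=
  Module.finrank K L = 2 ∧ ∀ᶠ v : HeightOneSpectrum (𝓞 K) in cofinite, ∀ α : Multiset ℂ, π.1.HasSatakeParamAt v α → α.map (fun a => (if ∃ w : HeightOneSpectrum (𝓞 L), w.asIdeal.under (𝓞 K) = v.asIdeal ∧ w.asIdeal.inertiaDeg (𝓞 K) = 1 then (1 : ℂ) else -1) * a) = α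

/-- The crux's COMPATIBILITY clause, VERBATIM: at almost every `v`, `π` is unramified with Satake
parameter `α`, `ρ` is unramified and every arithmetic Frobenius at `v` has characteristic polynomial
`arithFrobPolyOfSatake ι q_v 4 α` (C-normalisation of lang.S27). -/
def IsCompatibleWith (π : CuspidalAutomorphicRepData 4 K hcpt) {ℓ : ℕ} [Fact ℓ.Prime]
    (ι : PadicAlgCl ℓ ≃+* ℂ) (ρ : FramedGaloisRep K (PadicAlgCl ℓ) 4) : Prop :=
  ∀ᶠ v : HeightOneSpectrum (𝓞 K) in cofinite, ∃ α : Multiset ℂ, π.1.HasSatakeParamAt v α ∧ ρ.IsUnramifiedAt v ∧ ρ.HasFrobCharpolyAt v (arithFrobPolyOfSatake ι v.residueCard 4 α)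

/-- **AI datum**: `[L : K] = 2`, `π` is automorphically induced from the cuspidal `f` on `GL₂(𝔸_L)`
in Arthur–Clozel's sense at almost all places (`IsAutomorphicInductionAlong f.1 π.1`: split `v`:
`t_{π,v} = t_{f,w} ⊔ t_{f,w̄}`; inert `v`: `t_{π,v}` = the four square roots of the entries of
`t_{f,w}`), and `f` is not Galois-stable at Satake level (`f ≇ f^γ`). -/
def IsInducedFrom (π : CuspidalAutomorphicRepData 4 K hcpt) (L : Type) [Field L] [NumberField L]
    [Algebra K L] {hL2 : isCompact_glFiniteIntegralLevel 2 L} (f : CuspidalAutomorphicRepData 2 L hL2) :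
    Prop :=
  Module.finrank K L = 2 ∧ IsAutomorphicInductionAlong f.1 π.1 ∧ ¬ IsGaloisStableSatakeAE K f.1

variable {L : Type} [Field L] {ℓ : ℕ} [Fact ℓ.Prime]

/-- Shape (A) of a `4`-dimensional `ρ' : Γ_L → GL₄(ℚ̄_ℓ)` — **a sum of four characters** at the level
of characteristic polynomials: continuous characters `χ₀, …, χ₃ : Γ_L → ℚ̄_ℓ^×` with
`charpoly ρ'(σ) = ∏ᵢ (X - χᵢ(σ))` for every `σ` (for semisimple `ρ'`: `ρ' ≅ ⊕ᵢ χᵢ`, Brauer–Nesbitt). -/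
def IsSumOfFourCharacters (ρ' : FramedGaloisRep L (PadicAlgCl ℓ) 4) : Prop :=
  ∃ χ : Fin 4 → (absoluteGaloisGroup L →ₜ* (PadicAlgCl ℓ)ˣ),
    ∀ σ : absoluteGaloisGroup L, (ρ' σ).val.charpoly = ∏ i, (X - C ((χ i σ : (PadicAlgCl ℓ)ˣ) : PadicAlgCl ℓ))

/-- Shape (B) — **doubled irreducible**: a continuous IRREDUCIBLE `W : Γ_L → GL₂(ℚ̄_ℓ)` with
`charpoly ρ'(σ) = (charpoly W(σ))²` for every `σ` (for semisimple `ρ'`: `ρ' ≅ W ⊕ W`). -/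
def IsDoubledIrreducible (ρ' : FramedGaloisRep L (PadicAlgCl ℓ) 4) : Prop :=
  ∃ W : FramedGaloisRep L (PadicAlgCl ℓ) 2, W.toGaloisRep.IsIrreducible ∧
    ∀ σ : absoluteGaloisGroup L, (ρ' σ).val.charpoly = ((W σ).val.charpoly) ^ 2

end Interfaces

/-- Read-back: the crux, with its clauses named (definitional unfolding only). -/
theorem crux_iff : SelfTwistedIrreducible ↔
    ∀ (K : Type) [Field K] [NumberField K] (hcpt : isCompact_glFiniteIntegralLevel 4 K)
      (π : CuspidalAutomorphicRepData 4 K hcpt), π.1.IsCAlgebraic → HasHeckeField π →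
        (∃ (L' : Type) (_ : Field L') (_ : NumberField L') (_ : Algebra K L'), IsQuadSelfTwisted π L') →
          ∀ (ℓ : ℕ) [Fact ℓ.Prime] (ι : PadicAlgCl ℓ ≃+* ℂ) (ρ : FramedGaloisRep K (PadicAlgCl ℓ) 4),
            ρ.toGaloisRep.IsSemisimple → IsCompatibleWith π ι ρ → ρ.toGaloisRep.IsIrreducible :=
  Iff.rfl

/-! ## The four stubs -/

/-- **Stub 1 (automorphic induction; Arthur–Clozel; size M).** A cuspidal `π` on `GL₄(𝔸_K)` that is
self-twisted by `ε_{L/K}` at almost every place is automorphically induced from a cuspidal, non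
Galois-stable `f` on `GL₂(𝔸_L)`. Why plausibly true: Satake-level self-twist a.e. ⇒ `π ⊗ ε ≅ π`
(Jacquet–Shalika SMO, `JacquetShalikaAJM1981II` Thm 4.4) ⇒ Arthur–Clozel Ch. 3 Thm 4.2 (b): `BC_L π =
Π₁ ⊞ Π₁^γ`, `Π₁` cuspidal, `Π₁ ≇ Π₁^γ` ⇒ Lemma 6.4 / proof of Thm 6.2: the unique `π_F` lifted by
`Π₁ × Π₁^γ` is `π` and satisfies (6.1)–(6.2). Sources: ArthurClozelAMS120 Ch. 3 Thm 4.2 (b), Thm 6.2,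
Lemmas 6.3–6.4; LabesseLanglands1979 (n = 2 prototype). -/
theorem stub_automorphicInduction :
    ∀ (K : Type) [Field K] [NumberField K] (hcpt : isCompact_glFiniteIntegralLevel 4 K)
      (π : CuspidalAutomorphicRepData 4 K hcpt) (L : Type) [Field L] [NumberField L] [Algebra K L],
      IsQuadSelfTwisted π L → ∀ hL2 : isCompact_glFiniteIntegralLevel 2 L,
        ∃ f : CuspidalAutomorphicRepData 2 L hL2,
          IsAutomorphicInductionAlong f.1 π.1 ∧ ¬ IsGaloisStableSatakeAE K f.1 := by
  sorry

/-- **Stub 2 (Clifford dichotomy; size M).** For `π` self-twisted by `ε_{L/K}` a.e. and a semisimple,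
compatible, REDUCIBLE `ρ : Γ_K → GL₄(ℚ̄_ℓ)`: `ρ|_{Γ_L}` is a sum of four characters or is `W ⊕ W`
with `W` irreducible. Why plausibly true: inert `v` ⇒ `t_{π,v} = -t_{π,v}` ⇒ `tr ρ(Frob_v) = 0`;
Chebotarev (`chebotarev_artinRep_holds`, `absoluteGaloisGroup.frobenius_dense`) + continuity ⇒
`tr ρ = 0` on `ε = -1` ⇒ `ρ ≅ ρ ⊗ ε` (`FramedGaloisRep.nonempty_twist_equiv_of_trace_eq_zero`) ⇒
`ρ|_{Γ_L} = V ⊕ V^γ` (`ε`-fixed irreducible summands are induced from `Γ_L`, the others pair off as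
`σ, σ⊗ε`); `V` reducible ⇒ four characters; `V` irreducible and `ρ` reducible ⇒ `ρ = σ ⊕ σ⊗ε` with
`σ|_{Γ_L} = V` ⇒ doubled. Restriction to `Γ_L` stays semisimple (`RestrictFieldSemisimple`).
Sources: Curtis–Reiner I §11 (Clifford), SerreAbelianLadic1968 I.2; tree files named. -/
theorem stub_cliffordDichotomy :
    ∀ (K : Type) [Field K] [NumberField K] (hcpt : isCompact_glFiniteIntegralLevel 4 K)
      (π : CuspidalAutomorphicRepData 4 K hcpt) (L : Type) [Field L] [NumberField L] [Algebra K L],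
      IsQuadSelfTwisted π L → ∀ (ℓ : ℕ) [Fact ℓ.Prime] (ι : PadicAlgCl ℓ ≃+* ℂ)
        (ρ : FramedGaloisRep K (PadicAlgCl ℓ) 4), ρ.toGaloisRep.IsSemisimple → IsCompatibleWith π ι ρ →
          ¬ ρ.toGaloisRep.IsIrreducible →
            IsSumOfFourCharacters (ρ.restrictField L) ∨ IsDoubledIrreducible (ρ.restrictField L) := by
  sorry

/-- **Stub 3 (PotentiallyAbelianShapes excluded; size L).** If the cuspidal C-algebraic `π` with a
Hecke field is automorphically induced from a cuspidal `f` on `GL₂(𝔸_L)`, then no semisimple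
compatible `ρ` restricts to a sum of four characters on `Γ_L`. Why plausibly true: the characters are
weak abelian direct summands of `ρ|_{Γ_L}`, compatible a.e. with `t_{f,w} ⊔ t_{f,w̄}` (split) /
`t_{f,w} ⊔ t_{f,w}` (inert), hence locally algebraic and attached to algebraic Hecke characters `ψ_i`
of `L` (Böckle–Hui, PROVED: `exists_heckeCharacter_of_weaklyDivides_holds`), unitary by the Ramanujan
window; then `L^T(s, f × ψ₁⁻¹) L^T(s, f^γ × ψ₁⁻¹)` (entire: GL₂ × GL₁, `f` cuspidal) equals
`ζ_L^T(s) ∏_{i≥2} L^T(s, ψ_iψ₁⁻¹)` (pole at `s = 1`: `L(1, ψ) ≠ 0` for unitary `ψ`). Sources: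
BockleHui2025 Thm 1.1, JacquetShalikaAJM1981II, tree `JacquetShalikaEulerProducts`,
`StrongMultiplicityOneGLOne`, `HeckeLFunctionNonvanishingLineProofs`. -/
theorem stub_noFourCharacters :
    ∀ (K : Type) [Field K] [NumberField K] (hcpt : isCompact_glFiniteIntegralLevel 4 K)
      (π : CuspidalAutomorphicRepData 4 K hcpt), π.1.IsCAlgebraic → HasHeckeField π →
        ∀ (L : Type) [Field L] [NumberField L] [Algebra K L] (hL2 : isCompact_glFiniteIntegralLevel 2 L)
          (f : CuspidalAutomorphicRepData 2 L hL2), IsInducedFrom π L f →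
            ∀ (ℓ : ℕ) [Fact ℓ.Prime] (ι : PadicAlgCl ℓ ≃+* ℂ) (ρ : FramedGaloisRep K (PadicAlgCl ℓ) 4),
              ρ.toGaloisRep.IsSemisimple → IsCompatibleWith π ι ρ →
                ¬ IsSumOfFourCharacters (ρ.restrictField L) := by
  sorry

/-- **Stub 4 (DoubledPairRigidity + dihedral endgame; THE HARDEST STUB, size L).** If the cuspidal
C-algebraic `π` with a Hecke field is automorphically induced from a cuspidal `f` on `GL₂(𝔸_L)` that is
NOT Galois-stable, then no semisimple compatible `ρ` restricts to `W ⊕ W` (`W` irreducible) on `Γ_L`.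
Why plausibly true: at a.e. split `v = w w̄` an arithmetic Frobenius at `w` is one at `v`, so
`arithFrobPolyOfSatake ι q_v 4 (t_{f,w} + t_{f,w̄})` is a square and `t_{f,w} ⊔ t_{f,w̄}` is a doubled
pair: `t_{f,w} = t_{f,w̄}` off the scalar-Satake set `S`. Non-dihedral `f` (`¬ IsSatakeSelfTwist`):
`S` has upper Dirichlet density `≤ 1/9` (`|tr Ad t_{f,w}|² = 9` on `S` against the simple pole of
`L(s, Ad f × Ad f)`, Gelbart–Jacquet; prime powers by BlomerBrumley2011 `θ = 7/64 < 1/8`) `< 1/8`, so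
`f ≅ f^γ` by refined SMO (tree fact `Ramakrishnan1994_refinedSMO_GL2`), contradicting
`¬ IsGaloisStableSatakeAE`. Dihedral `f = AI_{M/L}(λ)`: `π = AI_{M/K}(λ)`
(`IsAutomorphicInductionAlong.trans`), `λ|·|^{3/2}` algebraic since `π` is C-algebraic, `ρ ≅ Ind_M^K λ_ℓ`
(Weil avatar `HeckeCharacterGaloisAvatarProofs` + Brauer–Nesbitt), irreducible by Mackey because `π` is
cuspidal (Jacquet–Shalika), and an irreducible `ρ` is never `W ⊕ W` on an index-2 subgroup
(`dim End ≤ 2`). WHY IT MIGHT FAIL (the crux's own): the `1/8` of Ramakrishnan1994 is a Dirichlet-density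
bound and `1/9` is reached only as an UPPER density with prime-power control — a density-notion mismatch,
or a dihedral `f` with `λ/λ^c` of small order, pushes everything onto the Weil-avatar branch. Sources:
Ramakrishnan1994, BlomerBrumley2011, GelbartJacquet1978, ArthurClozelAMS120 Ch. 3 §6, Shavali2026 §4. -/
theorem stub_noDoubledShape :
    ∀ (K : Type) [Field K] [NumberField K] (hcpt : isCompact_glFiniteIntegralLevel 4 K)
      (π : CuspidalAutomorphicRepData 4 K hcpt), π.1.IsCAlgebraic → HasHeckeField π →
        ∀ (L : Type) [Field L] [NumberField L] [Algebra K L] (hL2 : isCompact_glFiniteIntegralLevel 2 L)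
          (f : CuspidalAutomorphicRepData 2 L hL2), IsInducedFrom π L f →
            ∀ (ℓ : ℕ) [Fact ℓ.Prime] (ι : PadicAlgCl ℓ ≃+* ℂ) (ρ : FramedGaloisRep K (PadicAlgCl ℓ) 4),
              ρ.toGaloisRep.IsSemisimple → IsCompatibleWith π ι ρ →
                ¬ IsDoubledIrreducible (ρ.restrictField L) := by
  sorry

/-! ## Stub statements as named propositions (for the BC3 probes and the registrar) -/

namespace _Goal

/-- The statement of `stub_automorphicInduction` (literally its type). -/
def stub_automorphicInduction : Prop :=
  type_of% @Summit.Langlands.Langlands.Cruxes.SelfTwistedIrreducible.Birth.stub_automorphicInduction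

/-- The statement of `stub_cliffordDichotomy` (literally its type). -/
def stub_cliffordDichotomy : Prop :=
  type_of% @Summit.Langlands.Langlands.Cruxes.SelfTwistedIrreducible.Birth.stub_cliffordDichotomy

/-- The statement of `stub_noFourCharacters` (literally its type). -/
def stub_noFourCharacters : Prop :=
  type_of% @Summit.Langlands.Langlands.Cruxes.SelfTwistedIrreducible.Birth.stub_noFourCharacters

/-- The statement of `stub_noDoubledShape` (literally its type). -/
def stub_noDoubledShape : Prop :=
  type_of% @Summit.Langlands.Langlands.Cruxes.SelfTwistedIrreducible.Birth.stub_noDoubledShape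

end _Goal

/-- The stubs prove their named statements (read-back). -/
theorem goals_hold : _Goal.stub_automorphicInduction ∧ _Goal.stub_cliffordDichotomy ∧
    _Goal.stub_noFourCharacters ∧ _Goal.stub_noDoubledShape :=
  ⟨stub_automorphicInduction, stub_cliffordDichotomy, stub_noFourCharacters, stub_noDoubledShape⟩

/-! ## The composition: the four stubs imply the crux BY NAME -/

/-- **BC3 composition.** `stub_automorphicInduction → stub_cliffordDichotomy → stub_noFourCharacters →
stub_noDoubledShape → SelfTwistedIrreducible` (the route decl, by name): take the quadratic `L` of the
hypothesis, induce (`stub 1`, with the proved `isCompact_glFiniteIntegralLevel_holds 2 L`), suppose `ρ`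
reducible, split into the two shapes (`stub 2`) and kill each (`stubs 3, 4`). -/
theorem SelfTwistedIrreducible_of (h₁ : _Goal.stub_automorphicInduction)
    (h₂ : _Goal.stub_cliffordDichotomy) (h₃ : _Goal.stub_noFourCharacters)
    (h₄ : _Goal.stub_noDoubledShape) : SelfTwistedIrreducible := by
  intro K _ _ hcpt π hC hE hST ℓ _ ι ρ hss hcomp
  obtain ⟨L, _, _, _, hdeg, htw⟩ := hST
  have hq : IsQuadSelfTwisted π L := ⟨hdeg, htw⟩
  obtain ⟨f, hAI, hns⟩ := h₁ K hcpt π L hq (isCompact_glFiniteIntegralLevel_holds 2 L)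
  have hind : IsInducedFrom π L f := ⟨hdeg, hAI, hns⟩
  by_contra hirr
  rcases h₂ K hcpt π L hq ℓ ι ρ hss hcomp hirr with h4 | hdbl
  · exact h₃ K hcpt π hC hE L _ f hind ℓ ι ρ hss hcomp h4
  · exact h₄ K hcpt π hC hE L _ f hind ℓ ι ρ hss hcomp hdbl

/-- By-name sanity check (an `example`, not a declaration): the four stubs feed the composition. -/
example : SelfTwistedIrreducible :=
  SelfTwistedIrreducible_of stub_automorphicInduction stub_cliffordDichotomy stub_noFourCharacters
    stub_noDoubledShape

end Summit.Langlands.Langlands.Cruxes.SelfTwistedIrreducible.Birth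

end
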